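import Summits.ResolutionOfSingularities.ResolutionOfSingularities.Theorems.EquisingularLiftEquisingularLiftNatNoLevel
import HarnessLib

/-!
# [OURS] NO BLOW-UP DEPTH IN EVERY DIMENSION `≥ 2`: a hypersurface double point `y₀² + Ψ` with `Ψ ∈ (y)⁴` in `N + 1 ≥ 3` variables (3-jet `y₀²`,
# arbitrary tail) has NO `D`-level in any blow-up tower, every field — the negative criterion is not a surface phenomenon
# (cruxes `Theses.EquisingularLift.EquisingularLiftNat` (all `n`) / `…NatThree` / `EquisingularLift`, stmt-ResolutionOfSingularities-20038 / -20148 / -15660)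

[OURS · leafhand-res-equisingularlift-12 g1, 2026-09-01; cell `pub/decomp-res`] AI-produced, weaker than expert review; NOT a statement of any manuscript;
nothing here proves resolution of singularities in positive characteristic.  DEF-FREE helper; no `sorry`; standard axioms; ZERO named hypotheses.

✓ `towerLevel_none_origin_sq_add_pow_four` in any number `M + 3` of variables: chart `1` carries `T₀² + T₁²·R ∈ (T₀, T₁)²`, and `(T₀, T₁)` is a non-maximal
prime as soon as there is a third variable.  (For curves, `M + 3 = 2` is excluded: there point blow-ups do resolve.)  Relevant to the `n ≥ 4` stubs of
`EquisingularLiftNat` as much as to `n = 3`: point-blow-up depth is infinite at such points in every dimension.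

* ★★★ `OneStep.towerLevel_none_origin_sq_add_pow_four_anyDim` — `Ψ ∈ (y)⁴` ⟹ `∀ n, ¬ D n (Spec K[y₀,…,y_{M+2}]/(y₀² + Ψ)) (origin)`.

Closes no registered stub.

References: [StacksProject, Tag 0804]; [Matsumura1987, Thm. 14.2]; [Lipman1969, §24]; through the cited tree files.
-/

set_option linter.dupNamespace false -- mandated namespace `Summit.<Summit>.<Problem>` of this single-conjunct summit

noncomputable section

open CategoryTheory CategoryTheory.Limits AlgebraicGeometry TopologicalSpace Topology
open MvPolynomial
open Literature.AlgebraicGeometry.Resolution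
open AlgebraicGeometry.Scheme.IdealSheafData

namespace Summit.ResolutionOfSingularities.ResolutionOfSingularities.Cruxes.EquisingularLiftNat.Sections

namespace OneStep

variable (K : Type) [Field K]

/-- ★★★ **DOUBLE POINTS WITH 3-JET `y₀²` HAVE NO BLOW-UP DEPTH, IN EVERY DIMENSION `≥ 2`**: `M + 3` variables, `Ψ ∈ (y)⁴` arbitrary, every blow-up tower,
every field. [OURS] [cite: StacksProject, Tag 0804] [cite: Matsumura1987, Thm. 14.2] [cite: Lipman1969, §24] -/
theorem towerLevel_none_origin_sq_add_pow_four_anyDim {M : ℕ} (D : ℕ → ∀ Γ : Scheme.{0}, Γ → Prop)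
    (hD0 : ∀ (Γ : Scheme.{0}) (y : Γ), IsClosed (({y} : Set Γ)) →
      (D 0 Γ y ↔ ∀ (hy : IsClosed (({y} : Set Γ))) (Z : Scheme.{0}) (τ : Z ⟶ Γ), IsBlowup τ (vanishingIdeal ⟨{y}, hy⟩) →
        ∀ z : Z, τ z = y → IsRegularLocalRing (Z.presheaf.stalk z)))
    (hDsucc : ∀ (d : ℕ) (Γ : Scheme.{0}) (y : Γ), IsClosed (({y} : Set Γ)) →
      (D (d + 1) Γ y ↔ ∀ (hy : IsClosed (({y} : Set Γ))) (Z : Scheme.{0}) (τ : Z ⟶ Γ), IsBlowup τ (vanishingIdeal ⟨{y}, hy⟩) →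
        ∃ S' : Finset Z, (∀ z : Z, τ z = y → z ∉ S' → IsRegularLocalRing (Z.presheaf.stalk z)) ∧
          ∀ z ∈ S', τ z = y ∧ IsClosed (({z} : Set Z)) ∧ ∃ d' ≤ d, D d' Z z))
    (Ψ : MvPolynomial (Fin (M + 2 + 1)) K) (hΨ : Ψ ∈ Ideal.span (Set.range (X : Fin (M + 2 + 1) → MvPolynomial (Fin (M + 2 + 1)) K)) ^ 4)
    (y₀ : Spec (CommRingCat.of (MvPolynomial (Fin (M + 2 + 1)) K ⧸ Ideal.span {(X 0 ^ 2 : MvPolynomial (Fin (M + 2 + 1)) K) + Ψ})))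
    (hy₀ : y₀.asIdeal = Ideal.map (Ideal.Quotient.mk (Ideal.span {(X 0 ^ 2 : MvPolynomial (Fin (M + 2 + 1)) K) + Ψ}))
      (Ideal.span (Set.range (X : Fin (M + 2 + 1) → MvPolynomial (Fin (M + 2 + 1)) K)))) (n : ℕ) :
    ¬ D n (Spec (CommRingCat.of (MvPolynomial (Fin (M + 2 + 1)) K ⧸ Ideal.span {(X 0 ^ 2 : MvPolynomial (Fin (M + 2 + 1)) K) + Ψ}))) y₀ := by
  classical
  have h10 : (1 : Fin (M + 2 + 1)) ≠ 0 := by simp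
  have hmod : 2 % (M + 2 + 1) = 2 := Nat.mod_eq_of_lt (by omega)
  have h20 : (2 : Fin (M + 2 + 1)) ≠ 0 := by simp [Fin.ext_iff, hmod]
  have h21 : (2 : Fin (M + 2 + 1)) ≠ 1 := by
    simp only [ne_eq, Fin.ext_iff, Fin.val_two, Fin.val_one]
    omega
  have hΦ : (X 0 ^ 2 : MvPolynomial (Fin (M + 2 + 1)) K).IsHomogeneous 2 := isHomogeneous_X_pow (0 : Fin (M + 2 + 1)) 2
  have hΦ0 : (X 0 ^ 2 : MvPolynomial (Fin (M + 2 + 1)) K) ≠ 0 := pow_ne_zero _ (X_ne_zero 0)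
  have hΨ3 : Ψ ∈ Ideal.span (Set.range (X : Fin (M + 2 + 1) → MvPolynomial (Fin (M + 2 + 1)) K)) ^ (2 + 1) :=
    Ideal.pow_le_pow_right (by norm_num) hΨ
  -- chart `1`: `Ψ(…) = T₁⁴·R`, strict transform `T₀² + T₁²R`
  obtain ⟨R, hR⟩ := FirstOrderPoint.exists_aeval_subst_eq_pow_mul K 1 hΨ
  have hG : aeval (fun j => X 1 * Function.update (X : Fin (M + 2 + 1) → MvPolynomial (Fin (M + 2 + 1)) K) 1 1 j)
      ((X 0 ^ 2 : MvPolynomial (Fin (M + 2 + 1)) K) + Ψ) = X 1 ^ 2 * (X 0 ^ 2 + X 1 ^ 2 * R) := by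
    rw [map_add, hR, map_pow, aeval_X, Function.update_of_ne h10.symm]
    ring
  let P : Ideal (MvPolynomial (Fin (M + 2 + 1)) K) := Ideal.span (X '' ({0, 1} : Set (Fin (M + 2 + 1))))
  haveI hP : P.IsPrime := Literature.RingTheory.MvPolynomial.isPrime_span_X_image _
  have hX0 : (X 0 : MvPolynomial (Fin (M + 2 + 1)) K) ∈ P := Literature.RingTheory.MvPolynomial.X_mem_span_X_image_iff.mpr (by simp)
  have hX1 : (X 1 : MvPolynomial (Fin (M + 2 + 1)) K) ∈ P := Literature.RingTheory.MvPolynomial.X_mem_span_X_image_iff.mpr (by simp)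
  have hX2 : (X 2 : MvPolynomial (Fin (M + 2 + 1)) K) ∉ P := fun h => by
    have h' := Literature.RingTheory.MvPolynomial.X_mem_span_X_image_iff.mp h
    simp only [Set.mem_insert_iff, Set.mem_singleton_iff] at h'
    rcases h' with h' | h'
    · exact h20 h'
    · exact h21 h'
  have hPmax : ¬ P.IsMaximal := by
    intro hM
    let Q : Ideal (MvPolynomial (Fin (M + 2 + 1)) K) := Ideal.span (X '' (Set.univ : Set (Fin (M + 2 + 1))))
    haveI hQ : Q.IsPrime := Literature.RingTheory.MvPolynomial.isPrime_span_X_image _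
    have hPQ : P ≤ Q := Ideal.span_mono (Set.image_mono (Set.subset_univ _))
    have hEq : P = Q := hM.eq_of_le hQ.ne_top hPQ
    exact hX2 (hEq ▸ Literature.RingTheory.MvPolynomial.X_mem_span_X_image_iff.mpr (Set.mem_univ _))
  have hGP : (X 0 ^ 2 + X 1 ^ 2 * R : MvPolynomial (Fin (M + 2 + 1)) K) ∈ P ^ 2 :=
    Ideal.add_mem _ (Ideal.pow_mem_pow hX0 2) (Ideal.mul_mem_right _ _ (Ideal.pow_mem_pow hX1 2))
  have hG0 : (X 0 ^ 2 + X 1 ^ 2 * R : MvPolynomial (Fin (M + 2 + 1)) K) ≠ 0 := by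
    intro h
    have h1 := congrArg (eval (Pi.single (0 : Fin (M + 2 + 1)) (1 : K))) h
    simp at h1
  exact towerLevel_none_origin_of_mem_sq K D hD0 hDsucc (X 0 ^ 2) Ψ (by norm_num) hΦ hΦ0 hΨ3 1 _ hG0 hG P hPmax hX1 hGP y₀ hy₀ n

end OneStep

end Summit.ResolutionOfSingularities.ResolutionOfSingularities.Cruxes.EquisingularLiftNat.Sections

end
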